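import Mathlib.Analysis.Calculus.Deriv.Basic
import Mathlib.Analysis.Calculus.Deriv.Comp
import Mathlib.Analysis.Calculus.Deriv.Add
import Mathlib.Analysis.Calculus.Deriv.Mul
import Mathlib.Topology.Order.LeftRightNhds
import HarnessLib

/-!
# `C¹` gluing of barrier pieces (left barrier of the `γ = 5/3` implosion profile)

The far part of the left barrier (Proposition 3.3 of Buckmaster–Cao-Labora–Gómez-Serrano,
replaced at `γ = 5/3` by explicit polynomial pieces) is a piecewise-polynomial `C¹` graph: the
pieces are glued by `if` at the breakpoints with matching values and matching derivatives. This
file proves the elementary calculus fact used for the gluing.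

[cite: BuckmasterCaolaboraGomezserrano2025, Prop. 3.3]
-/

noncomputable section

open Set Filter Topology

namespace Literature.Analysis.FluidPDE

namespace BuckmasterCaolaboraGomezserrano2025

namespace Monatomic

namespace LeftFar

/-- **`C¹` gluing.** If `f, g` are differentiable everywhere with derivatives `f', g'`, and
`f a = g a`, `f' a = g' a`, then `x ↦ if a ≤ x then f x else g x` is differentiable everywhere
with derivative `if a ≤ x then f' x else g' x`. [folklore] -/
theorem hasDerivAt_ite {f g f' g' : ℝ → ℝ} {a : ℝ} (hf : ∀ x, HasDerivAt f (f' x) x)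
    (hg : ∀ x, HasDerivAt g (g' x) x) (hv : f a = g a) (hd : f' a = g' a) (x : ℝ) :
    HasDerivAt (fun y => if a ≤ y then f y else g y) (if a ≤ x then f' x else g' x) x := by
  rcases lt_trichotomy x a with h | h | h
  · rw [if_neg (not_le.mpr h)]
    refine (hg x).congr_of_eventuallyEq ?_
    filter_upwards [Iio_mem_nhds h] with y hy
    rw [if_neg (not_le.mpr hy)]
  · subst h
    rw [if_pos le_rfl]
    have hl : HasDerivWithinAt (fun y => if x ≤ y then f y else g y) (f' x) (Iic x) x := by
      have h0 := (hg x).hasDerivWithinAt (s := Iic x)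
      rw [← hd] at h0
      refine h0.congr_of_eventuallyEq (eventually_nhdsWithin_of_forall fun y hy => ?_) (by simp [hv])
      rcases eq_or_lt_of_le (show y ≤ x from hy) with h' | h'
      · subst h'; simp [hv]
      · show (if x ≤ y then f y else g y) = g y
        rw [if_neg (not_le.mpr h')]
    have hr : HasDerivWithinAt (fun y => if x ≤ y then f y else g y) (f' x) (Ici x) x := by
      refine (hf x).hasDerivWithinAt.congr_of_eventuallyEq
        (eventually_nhdsWithin_of_forall fun y hy => ?_) (by simp)
      show (if x ≤ y then f y else g y) = f y
      rw [if_pos (show x ≤ y from hy)]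
    have := hl.union hr
    rwa [Iic_union_Ici, hasDerivWithinAt_univ] at this
  · rw [if_pos h.le]
    refine (hf x).congr_of_eventuallyEq ?_
    filter_upwards [Ioi_mem_nhds h] with y hy
    rw [if_pos (le_of_lt hy)]

/-- Value of the glued function. [folklore] -/
theorem ite_apply_of_le {f g : ℝ → ℝ} {a x : ℝ} (h : a ≤ x) :
    (if a ≤ x then f x else g x) = f x := if_pos h

/-- Value of the glued function. [folklore] -/
theorem ite_apply_of_gt {f g : ℝ → ℝ} {a x : ℝ} (h : x < a) :
    (if a ≤ x then f x else g x) = g x := if_neg (not_le.mpr h)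

/-- Derivative of a piece in the reversed local coordinate `u = (a − x)/ℓ`:
`(d/dx) P((a − x)/ℓ) = −P′/ℓ`. [folklore] -/
theorem hasDerivAt_comp_rev_affine {P : ℝ → ℝ} {P' a ℓ x : ℝ}
    (hP : HasDerivAt P P' ((a - x) / ℓ)) :
    HasDerivAt (fun y => P ((a - y) / ℓ)) (-P' / ℓ) x := by
  have h1 : HasDerivAt (fun y : ℝ => (a - y) / ℓ) (-1 / ℓ) x := by
    have := HasDerivAt.div_const (HasDerivAt.const_sub a (hasDerivAt_id x)) ℓ
    simpa using this
  have h2 := HasDerivAt.comp x hP h1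
  have e : -P' / ℓ = P' * (-1 / ℓ) := by ring
  rw [e]; exact h2

end LeftFar

end Monatomic

end BuckmasterCaolaboraGomezserrano2025

end Literature.Analysis.FluidPDE
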